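import Mathlib
import Literature.NumberTheory.Transcendental.KZRulesAssociator
import Literature.NumberTheory.Transcendental.KZProductIdeal
import Literature.NumberTheory.Transcendental.KZGaussMultiplicationChain
import Literature.NumberTheory.Transcendental.LindemannWeierstrassProofs
import Summits.KontsevichZagierPeriods.KontsevichZagierPeriods.Theorems.HyperbolicBlochOffTetraSectorKernelStubLindemannRing
import Summits.KontsevichZagierPeriods.KontsevichZagierPeriods.Theorems.HyperbolicBlochOffTetraSectorKernelRungZeroLogRelations
import Summits.KontsevichZagierPeriods.KontsevichZagierPeriods.Theorems.HyperbolicBlochOffTetraSectorKernelRungZeroInjectivity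

/-!
# Stub `stub_hermiteLindemannRing` — crux `OffTetraSectorKernel`, line `odd-hyperbolic-ladder` (skeleton v8, lead c6)

CONJECTURE 1 HOLDS ON THE RING OF ONE LOGARITHM. The method of `stub_lindemannRing` is a general principle
(`transcendentalRing_kernel`): in the formal period ring `P = FormalRep ⧸ relations`, the subring generated
by the algebraic points `⟦[pt, a]⟧` and ONE class `t` whose value is TRANSCENDENTAL over `ℚ` meets the kernel
of `evalP` only in `0` — its elements are `p(t)`, `p ∈ K[X]`, `K = algebraicClosure ℚ ℝ`, and `p(evalP t) = 0`
forces `p = 0`. Two transcendence theorems PROVED in the tree feed it: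

* Lindemann (`transcendental_pi_holds`): `t` = the arctangent carrier, value `π/4` — `stub_lindemannRing`;
* HERMITE–LINDEMANN (`transcendental_exp_holds`: `e^α ∉ ℚ̄` for algebraic `α ≠ 0`): `t` = the LOGARITHM
  CARRIER `Λ(a) = [(1,a), dt/t]` of a real algebraic `a > 1` (a rung-`0` polytope of the hyperbolic line,
  value the hyperbolic length `log a`, which is transcendental: were it algebraic, `a = e^{log a}` would be
  transcendental) — `stub_hermiteLindemannRing` below.

So every POLYNOMIAL identity in ONE logarithm of an algebraic number (with algebraic coefficients) between
KZ periods built from points, `Λ(a)` and their Fubini products is a chain of moves; what Baker (c5, linear)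
and this file (one logarithm, any degree) leave open at weight two is exactly the MIXED products
`log a · log b` (`a`, `b` multiplicatively independent: four-exponentials territory) and `π · log a`.

References: Ch. Hermite (1873); F. Lindemann, Math. Ann. 20 (1882); A. Baker, *Transcendental Number
Theory* (1975), Ch. 1, Thm 1.4; M. Kontsevich, D. Zagier, *Periods* (2001), §1.2, §4.1.
-/

noncomputable section

open Set MeasureTheory
open Literature.NumberTheory.Transcendental

namespace Summit.KontsevichZagierPeriods.HyperbolicBloch.OffTetraSectorKernel

/-! ## The general principle -/

/-- **TRANSCENDENTAL-GENERATOR PRINCIPLE.** Let `G ⊆ P` consist of copies of one class `t` with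
`evalP t` transcendental over `ℚ`. Then on the subring generated by the algebraic points and `G`,
`evalP x = 0 → x = 0`: the points are the image of the ring homomorphism `K = algebraicClosure ℚ ℝ →+* P`
(`lindemann_pt_add/_mul/_one/_zero`), so every element is `p(t)` with `p ∈ K[X]`
(`Polynomial.eval₂RingHom`), `evalP (p(t)) = p(evalP t)`, and a non-zero `p` would make `evalP t`
algebraic over `K`, hence over `ℚ` (`IsAlgebraic.restrictScalars`). [cite: KontsevichZagier2001, §4.1] -/
theorem transcendentalRing_kernel (t : KZ.FormalPeriodRing) (ht : Transcendental ℚ (KZ.evalP t))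
    (G : Set KZ.FormalPeriodRing) (hG : ∀ g ∈ G, g = t) :
    ∀ x ∈ Subring.closure
        ({p : KZ.FormalPeriodRing | ∃ (a : ℝ) (ha : IsAlgebraic ℚ a),
            p = KZ.toFormalPeriod (KZ.of (KZ.IntegralRep.unit.constMul a ha))} ∪ G),
      KZ.evalP x = 0 → x = 0 := by
  intro x hx hx0
  let K := algebraicClosure ℚ ℝ
  haveI hKalg : Algebra.IsAlgebraic ℚ K := algebraicClosure.isAlgebraic ℚ ℝ
  let φ : K →+* KZ.FormalPeriodRing :=
    { toFun := fun a => KZ.toFormalPeriod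
        (KZ.of (KZ.IntegralRep.unit.constMul (a : ℝ) ((mem_algebraicClosure_iff).mp a.2)))
      map_one' := (lindemann_pt_congr _ isAlgebraic_one (by simp)).trans lindemann_pt_one
      map_mul' := fun a b =>
        (lindemann_pt_congr _ (((mem_algebraicClosure_iff).mp a.2).mul
          ((mem_algebraicClosure_iff).mp b.2)) (by push_cast; rfl)).trans (lindemann_pt_mul _ _)
      map_zero' := (lindemann_pt_congr _ isAlgebraic_zero (by simp)).trans lindemann_pt_zero
      map_add' := fun a b =>
        (lindemann_pt_congr _ (((mem_algebraicClosure_iff).mp a.2).add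
          ((mem_algebraicClosure_iff).mp b.2)) (by push_cast; rfl)).trans (lindemann_pt_add _ _) }
  have hφ : ∀ a : K, KZ.evalP (φ a) = (a : ℝ) := fun a => lindemann_evalP_pt _
  have hle : Subring.closure
      ({p : KZ.FormalPeriodRing | ∃ (a : ℝ) (ha : IsAlgebraic ℚ a),
          p = KZ.toFormalPeriod (KZ.of (KZ.IntegralRep.unit.constMul a ha))} ∪ G) ≤
        (Polynomial.eval₂RingHom φ t).range := by
    refine (Subring.closure_le).mpr ?_
    rintro q (⟨a, ha, rfl⟩ | hq)
    · refine ⟨Polynomial.C (⟨a, (mem_algebraicClosure_iff).mpr ha⟩ : K), ?_⟩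
      rw [Polynomial.coe_eval₂RingHom, Polynomial.eval₂_C]
      rfl
    · refine ⟨Polynomial.X, ?_⟩
      rw [Polynomial.coe_eval₂RingHom, Polynomial.eval₂_X, hG q hq]
  obtain ⟨p, hp⟩ := hle hx
  have hcomp : KZ.evalP.comp φ = algebraMap K ℝ := by
    ext a
    rw [RingHom.comp_apply, hφ]
    rfl
  have hev : KZ.evalP x = Polynomial.aeval (KZ.evalP t) p := by
    rw [← hp, Polynomial.coe_eval₂RingHom, Polynomial.hom_eval₂, hcomp, Polynomial.aeval_def]
  by_cases hp0 : p = 0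
  · rw [← hp, hp0, map_zero]
  · exfalso
    have hK : IsAlgebraic K (KZ.evalP t) := ⟨p, hp0, by rw [← hev, hx0]⟩
    exact ht (hK.restrictScalars ℚ)

/-! ## The logarithm carrier -/

/-- Two logarithm carriers pinned by the same interval `(1,a)` and the integrand `dt/t` have the same
class (rule (1b) with a zero difference). [cite: KontsevichZagier2001, §1.2 rule (1)] -/
theorem hermiteLindemann_log_class_eq {a : ℝ} (Λ Λ' : KZ.IntegralRep 1)
    (hΛd : Λ.domain = {t | 1 < t 0 ∧ t 0 < a}) (hΛi : Set.EqOn Λ.integrand (fun t => 1 / t 0) Λ.domain)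
    (hΛ'd : Λ'.domain = {t | 1 < t 0 ∧ t 0 < a}) (hΛ'i : Set.EqOn Λ'.integrand (fun t => 1 / t 0) Λ'.domain) :
    KZ.toFormalPeriod (KZ.of Λ) = KZ.toFormalPeriod (KZ.of Λ') := by
  refine KZ.toFormalPeriod_eq_iff.mpr (KZ.of_sub_of_mem_relations_of_eqOn (hΛ'd.trans hΛd.symm)
    fun x hx => ?_)
  have hx' : x ∈ Λ'.domain := by rwa [hΛ'd, ← hΛd]
  rw [hΛi hx, hΛ'i hx']

/-- **The logarithm carrier evaluates to the hyperbolic length `log a`** (`1 ≤ a`).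
[cite: KontsevichZagier2001, §1.1] -/
theorem hermiteLindemann_evalP_log {a : ℝ} (ha : 1 ≤ a) (Λ : KZ.IntegralRep 1)
    (hΛd : Λ.domain = {t | 1 < t 0 ∧ t 0 < a}) (hΛi : Set.EqOn Λ.integrand (fun t => 1 / t 0) Λ.domain) :
    KZ.evalP (KZ.toFormalPeriod (KZ.of Λ)) = Real.log a := by
  rw [KZ.evalP_toFormalPeriod_of, KZ.IntegralRep.value,
    setIntegral_congr_fun (KZ.IntegralRep.measurableSet_domain_holds Λ) hΛi, hΛd]
  have h := rungZero_setIntegral_hypDensity_interval (α := 1) (β := a) one_pos ha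
  rw [rungZero_hypDensity_eq, div_one] at h
  rw [← h]
  exact setIntegral_congr_fun (hΛd ▸ KZ.IntegralRep.measurableSet_domain_holds Λ) fun p _ => by
    simp [one_div]

/-- **`log a` is transcendental for real algebraic `a > 1`** (Hermite–Lindemann, tree theorem
`transcendental_exp_holds`): were `log a` algebraic, so would be `e^{log a} = a`'s logarithm as a complex
number, and then `a = e^{log a}` would be transcendental. [cite: Lindemann1882] -/
theorem hermiteLindemann_transcendental_log {a : ℝ} (halg : IsAlgebraic ℚ a) (ha : 1 < a) :
    Transcendental ℚ (Real.log a) := by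
  intro hlog
  have ha0 : 0 < a := by linarith
  have hne : (Real.log a : ℂ) ≠ 0 := by
    exact_mod_cast (Real.log_pos ha).ne'
  have hC : IsAlgebraic ℚ (Real.log a : ℂ) := hlog.algebraMap
  have htr : Transcendental ℚ (Complex.exp (Real.log a : ℂ)) := transcendental_exp_holds hC hne
  apply htr
  rw [← Complex.ofReal_exp, Real.exp_log ha0]
  exact halg.algebraMap

/-- A logarithm carrier `[(1,a), dt/t]` exists for real algebraic `a`. [cite: KontsevichZagier2001, §1.1] -/
theorem hermiteLindemann_exists_log {a : ℝ} (halg : IsAlgebraic ℚ a) :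
    ∃ Λ : KZ.IntegralRep 1, Λ.domain = {t | 1 < t 0 ∧ t 0 < a} ∧
      Set.EqOn Λ.integrand (fun t => 1 / t 0) Λ.domain := by
  obtain ⟨Λ, hΛd, hΛi⟩ := exists_logRep (a := 1) (b := a) one_pos isAlgebraic_one halg
  exact ⟨Λ, hΛd, fun x _ => by rw [hΛi]⟩

/-! ## The ring of one logarithm -/

/-- **STUB `stub_hermiteLindemannRing`: CONJECTURE 1 HOLDS ON THE RING OF ONE LOGARITHM.** For a real
algebraic `a > 1`, on the subring of the formal period ring `P = FormalRep ⧸ relations` generated by the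
algebraic points `⟦[pt, c]⟧` and the logarithm carriers `⟦[(1,a), dt/t]⟧` (value `log a`),
`evalP x = 0 → x = 0`: every element is `p(⟦Λ(a)⟧)` for a polynomial `p` with real-algebraic coefficients,
and `p(log a) = 0` forces `p = 0` since `log a` is transcendental (Hermite–Lindemann; tree theorem
`transcendental_exp_holds`). Every polynomial identity in ONE logarithm between such periods is a chain
of moves. [cite: Lindemann1882] [cite: KontsevichZagier2001, §1.2] -/
theorem stub_hermiteLindemannRing :
    ∀ (a : ℝ), IsAlgebraic ℚ a → 1 < a →
    ∀ x ∈ Subring.closure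
        ({p : KZ.FormalPeriodRing | ∃ (c : ℝ) (hc : IsAlgebraic ℚ c),
            p = KZ.toFormalPeriod (KZ.of (KZ.IntegralRep.unit.constMul c hc))} ∪
          {p : KZ.FormalPeriodRing | ∃ Λ : KZ.IntegralRep 1, Λ.domain = {t | 1 < t 0 ∧ t 0 < a} ∧
            Set.EqOn Λ.integrand (fun t => 1 / t 0) Λ.domain ∧ p = KZ.toFormalPeriod (KZ.of Λ)}),
      KZ.evalP x = 0 → x = 0 := by
  intro a halg ha
  obtain ⟨Λ₀, hΛ₀d, hΛ₀i⟩ := hermiteLindemann_exists_log halg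
  refine transcendentalRing_kernel (KZ.toFormalPeriod (KZ.of Λ₀)) ?_ _ ?_
  · rw [hermiteLindemann_evalP_log ha.le Λ₀ hΛ₀d hΛ₀i]
    exact hermiteLindemann_transcendental_log halg ha
  · rintro g ⟨Λ, hΛd, hΛi, rfl⟩
    exact hermiteLindemann_log_class_eq Λ Λ₀ hΛd hΛi hΛ₀d hΛ₀i

/-- **THE RING OF ONE LOGARITHM IS A CLOSED SECTOR OF THE RESIDUE**: for real algebraic `a > 1`, on the formal
combinations whose class lies in the subring generated by the points and `Λ(a)`, `ker eval ≤ relations`.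
[cite: KontsevichZagier2001, §1.2] -/
theorem hermiteLindemannRing_inf_ker_le_relations {a : ℝ} (halg : IsAlgebraic ℚ a) (ha : 1 < a) :
    KZ.eval.ker ⊓ (Subring.closure
        ({p : KZ.FormalPeriodRing | ∃ (c : ℝ) (hc : IsAlgebraic ℚ c),
            p = KZ.toFormalPeriod (KZ.of (KZ.IntegralRep.unit.constMul c hc))} ∪
          {p : KZ.FormalPeriodRing | ∃ Λ : KZ.IntegralRep 1, Λ.domain = {t | 1 < t 0 ∧ t 0 < a} ∧
            Set.EqOn Λ.integrand (fun t => 1 / t 0) Λ.domain ∧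
            p = KZ.toFormalPeriod (KZ.of Λ)})).toAddSubgroup.comap
        KZ.toFormalPeriod.toAddMonoidHom ≤ KZ.relations := by
  rintro c ⟨hc, hS⟩
  have hc0 : KZ.eval c = 0 := hc
  have hS' : KZ.toFormalPeriod c ∈ Subring.closure
      ({p : KZ.FormalPeriodRing | ∃ (c : ℝ) (hc : IsAlgebraic ℚ c),
          p = KZ.toFormalPeriod (KZ.of (KZ.IntegralRep.unit.constMul c hc))} ∪
        {p : KZ.FormalPeriodRing | ∃ Λ : KZ.IntegralRep 1, Λ.domain = {t | 1 < t 0 ∧ t 0 < a} ∧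
          Set.EqOn Λ.integrand (fun t => 1 / t 0) Λ.domain ∧ p = KZ.toFormalPeriod (KZ.of Λ)}) := hS
  exact KZ.toFormalPeriod_eq_zero_iff.mp
    (stub_hermiteLindemannRing a halg ha _ hS' (by rw [KZ.evalP_toFormalPeriod, hc0]))

/-- **Powers of the logarithm carrier against rung-`0` polytopes**: `⟦[(1, a^n), dt/t]⟧ = n · ⟦[(1,a), dt/t]⟧`
lies in the ring of one logarithm (`log aⁿ − n log a = 0` is a rung-`0` value-relator, hence a relation:
c1's `interval_log_relation_mem_relations`). [cite: KontsevichZagier2001, §1.2] -/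
theorem hermiteLindemann_mem_logPow {a : ℝ} (halg : IsAlgebraic ℚ a) (ha : 1 < a) (n : ℕ)
    (R : KZ.IntegralRep 1) (hRd : R.domain = {t | 1 < t 0 ∧ t 0 < a ^ n})
    (hRi : Set.EqOn R.integrand (fun t => 1 / t 0) R.domain) :
    KZ.toFormalPeriod (KZ.of R) ∈ Subring.closure
      ({p : KZ.FormalPeriodRing | ∃ (c : ℝ) (hc : IsAlgebraic ℚ c),
          p = KZ.toFormalPeriod (KZ.of (KZ.IntegralRep.unit.constMul c hc))} ∪
        {p : KZ.FormalPeriodRing | ∃ Λ : KZ.IntegralRep 1, Λ.domain = {t | 1 < t 0 ∧ t 0 < a} ∧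
          Set.EqOn Λ.integrand (fun t => 1 / t 0) Λ.domain ∧ p = KZ.toFormalPeriod (KZ.of Λ)}) := by
  obtain ⟨Λ, hΛd, hΛi⟩ := hermiteLindemann_exists_log halg
  -- the rung-0 value relator `[R] − n • [Λ]`
  have hrel := interval_log_relation_mem_relations 2 ![1, 1] ![a ^ n, a] ![1, -(n : ℤ)] ![R, Λ]
    (fun i => by fin_cases i <;> simp)
    (fun i => by fin_cases i <;> simp [one_le_pow₀ ha.le, ha.le])
    (fun i => by fin_cases i <;> exact isAlgebraic_one)
    (fun i => by fin_cases i <;> simp [halg.pow n, halg])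
    (fun i => by
      fin_cases i
      · exact ⟨hRd, hRi⟩
      · exact ⟨hΛd, hΛi⟩)
    (by simp [Fin.sum_univ_two, Real.log_pow])
  have hrel' : KZ.of R - n • KZ.of Λ ∈ KZ.relations := by
    have e : ∑ i : Fin 2, (![1, -(n : ℤ)] i) • KZ.of (![R, Λ] i) = KZ.of R - n • KZ.of Λ := by
      simp [Fin.sum_univ_two, sub_eq_add_neg, neg_smul, natCast_zsmul]
    rw [← e]
    exact hrel
  rw [KZ.toFormalPeriod_eq_iff.mpr hrel', map_nsmul]
  refine nsmul_mem ?_ n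
  exact Subring.subset_closure (Or.inr ⟨Λ, hΛd, hΛi, rfl⟩)

end Summit.KontsevichZagierPeriods.HyperbolicBloch.OffTetraSectorKernel

end
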